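import Mathlib.Algebra.Polynomial.Inductions
import Mathlib.Algebra.Polynomial.Eval.Defs
import Mathlib.Tactic
import HarnessLib

/-!
# Connes–Consani 2023, *On the metaphysics of 𝔽₁* — `𝕊[μ_{n,+}]`-generators (Def. 5.1); `ℤ` over `𝕊[±1]` (`X = 3`) and over `𝕊` (`X = −2`), PROVED

A. Connes, C. Consani, *On the metaphysics of 𝔽₁*, Rend. Lincei Mat. Appl. 34 (2023) (= arXiv:2307.06748;
dedicated to Yu. I. Manin) [bib: `ConnesConsani2023MetaphysicsF1`].  This is the paper whose open
question (p. 4: "does there exist a category in which one can define 'absolute Descartes powers'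
Spec ℤ × ⋯ × Spec ℤ?") is the HEADLINE LOCATOR of the cell `pub-rhdoor`'s located gap; here (seat cc-2)
its definitional content is typed and its two theorems about `ℤ` PROVED.  No zeta / positivity content.

* **Definition 5.1** (§5 p. 16): "Let `R` be a ring, `ι : μ_n → R^×` be an injective group homomorphism.
  An element `X ∈ R` is an `𝕊[μ_{n,+}]`-generator of `R` if and only if every element `z ∈ R` can be
  written uniquely as a polynomial `z = Σ_j ι(α_j) X^j` with coefficients `α_j ∈ μ_n ∪ {0}`."  Typed with
  Mathlib polynomials: `IsPolyGenerator D X` — every `z` is `P(X)` for a UNIQUE polynomial `P` over `R` all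
  of whose coefficients lie in the digit set `D`; `IsSMuGenerator n X := IsPolyGenerator ({0} ∪ {x | x^n = 1}) X`
  (digits = the `n`-th roots of unity of `R` and `0`; this is `ι(μ_n) ∪ {0}` when `R` has `n` distinct `n`-th
  roots of unity — for `R = ℤ`: `n = 1` gives `{0, 1}` (base `𝕊`), `n = 2` gives `{0, ±1}` (`𝕊[±1]`)).
* **Proposition 6.5** (§6 p. 25, first clause): "Let `R = ℤ`, `X = 3` is an `𝕊[±1]`-generator of `R`"
  (= footnote 1 of CC's *RR for the ring ℤ*: "every integer is uniquely of the form `P(X)` where `P` is a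
  polynomial with coefficients in `{−1,0,1}` and `X = 3`") — `isSMuGenerator_two_int_three`, PROVED
  (balanced ternary: existence by `z = 3z' + d`, `d ∈ {−1,0,1}`, `|z'| < |z|`; uniqueness mod `3`).
* **§4 p. 14**: "The number `X = −2` is remarkably unique, making the representation of an integer `n`
  possible as polynomial `P(X)` with coefficients `α_j ∈ {0, 1}`" (= footnote 2 of *RR for the ring ℤ*:
  "every integer is uniquely of the form `P(X)` … coefficients in `{0,1}` and `X = −2`") —
  `isSMuGenerator_one_int_neg_two`, PROVED (negabinary: `z = −2z' + (z mod 2)`; uniqueness mod `2`).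

Deliberately NOT typed: the "hold" (Def. 5.14), Prop. 5.8, Cor. 5.16 (`n + 1` a prime power), the
quadratic-field examples of §6 (Props. 6.2–6.13), the Witt-vector clauses (i)–(iii) of Prop. 6.5.
-/

noncomputable section

open Polynomial

namespace Literature.NumberTheory.ConnesConsani2023

/-! ## Definition 5.1 -/

/-- **`X` generates `R` as "polynomials with digits in `D`"** (the shape of Def. 5.1, p. 16, for a digit
set `D ⊆ R`): every `z ∈ R` is `P(X)` for a UNIQUE polynomial `P` over `R` all of whose coefficients lie in
`D` (`0 ∈ D` is forced by the vanishing high coefficients). [cite: ConnesConsani2023MetaphysicsF1, Def. 5.1 p. 16] -/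
def IsPolyGenerator {R : Type*} [CommRing R] (D : Set R) (X : R) : Prop :=
  ∀ z : R, ∃! P : R[X], (∀ j, P.coeff j ∈ D) ∧ P.eval X = z

/-- **Definition 5.1** (p. 16): `X` is an `𝕊[μ_{n,+}]`-generator of `R` — digits `ι(μ_n) ∪ {0}`, typed as
`{0} ∪ {x ∈ R | x^n = 1}`. [cite: ConnesConsani2023MetaphysicsF1, Def. 5.1 p. 16] -/
def IsSMuGenerator {R : Type*} [CommRing R] (n : ℕ) (X : R) : Prop :=
  IsPolyGenerator (insert 0 {x : R | x ^ n = 1}) X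

/-- The digit set of `𝕊 = 𝕊[μ_{1,+}]` in `ℤ` is `{0, 1}`. [cite: ConnesConsani2023MetaphysicsF1, §4 p. 14] -/
theorem mem_digits_one_int (x : ℤ) : x ∈ (insert 0 {x : ℤ | x ^ 1 = 1} : Set ℤ) ↔ x = 0 ∨ x = 1 := by
  simp

/-- The digit set of `𝕊[±1] = 𝕊[μ_{2,+}]` in `ℤ` is `{0, 1, −1}`. [cite: ConnesConsani2023MetaphysicsF1, Prop. 6.5 p. 25] -/
theorem mem_digits_two_int (x : ℤ) :
    x ∈ (insert 0 {x : ℤ | x ^ 2 = 1} : Set ℤ) ↔ x = 0 ∨ x = 1 ∨ x = -1 := by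
  simp only [Set.mem_insert_iff, Set.mem_setOf_eq]
  constructor
  · rintro (h | h)
    · exact Or.inl h
    · exact Or.inr (sq_eq_one_iff.mp h |>.imp id id)
  · rintro (h | h | h)
    · exact Or.inl h
    · exact Or.inr (by rw [h]; norm_num)
    · exact Or.inr (by rw [h]; norm_num)

/-! ## Generic uniqueness: digits pairwise incongruent mod `b` ⇒ at most one digit polynomial per value -/

/-- If distinct digits of `D ⊆ ℤ` are incongruent modulo `b` and `|b| ≥ 2`, then two polynomials with
coefficients in `D` and the same value at `b` are equal (compare constant terms mod `b`, divide by `b`,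
induct on the degrees). [folklore] -/
private theorem poly_unique {b : ℤ} (hb : 2 ≤ |b|) {D : Set ℤ}
    (hD : ∀ d ∈ D, ∀ d' ∈ D, b ∣ (d - d') → d = d') :
    ∀ (P Q : ℤ[X]), (∀ j, P.coeff j ∈ D) → (∀ j, Q.coeff j ∈ D) → P.eval b = Q.eval b → P = Q := by
  have hb0 : b ≠ 0 := by intro h; rw [h, abs_zero] at hb; omega
  -- induction on `P.natDegree + Q.natDegree`
  suffices H : ∀ N : ℕ, ∀ (P Q : ℤ[X]), P.natDegree + Q.natDegree ≤ N →
      (∀ j, P.coeff j ∈ D) → (∀ j, Q.coeff j ∈ D) → P.eval b = Q.eval b → P = Q from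
    fun P Q => H _ P Q le_rfl
  intro N
  induction N with
  | zero =>
    intro P Q hN hP hQ hev
    have hP0 : P.natDegree = 0 := by omega
    have hQ0 : Q.natDegree = 0 := by omega
    rw [Polynomial.eq_C_of_natDegree_eq_zero hP0, Polynomial.eq_C_of_natDegree_eq_zero hQ0] at hev ⊢
    simp only [eval_C] at hev
    rw [hev]
  | succ N ih =>
    intro P Q hN hP hQ hev
    -- constant terms agree mod b, hence are equal
    have hdecP := Polynomial.X_mul_divX_add P
    have hdecQ := Polynomial.X_mul_divX_add Q
    have hevP : P.eval b = b * (divX P).eval b + P.coeff 0 := by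
      conv_lhs => rw [← hdecP]
      simp [eval_add, eval_mul, eval_X]
    have hevQ : Q.eval b = b * (divX Q).eval b + Q.coeff 0 := by
      conv_lhs => rw [← hdecQ]
      simp [eval_add, eval_mul, eval_X]
    have h0 : P.coeff 0 = Q.coeff 0 := by
      apply hD _ (hP 0) _ (hQ 0)
      refine ⟨(divX Q).eval b - (divX P).eval b, ?_⟩
      have := hev; rw [hevP, hevQ] at this; linarith
    have hev' : (divX P).eval b = (divX Q).eval b := by
      have := hev; rw [hevP, hevQ, h0] at this
      exact mul_left_cancel₀ hb0 (by linarith)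
    have hPd : ∀ j, (divX P).coeff j ∈ D := fun j => by rw [coeff_divX]; exact hP _
    have hQd : ∀ j, (divX Q).coeff j ∈ D := fun j => by rw [coeff_divX]; exact hQ _
    by_cases hdeg : P.natDegree = 0 ∧ Q.natDegree = 0
    · rw [Polynomial.eq_C_of_natDegree_eq_zero hdeg.1, Polynomial.eq_C_of_natDegree_eq_zero hdeg.2, h0]
    · -- degrees drop under divX
      have hlt : (divX P).natDegree + (divX Q).natDegree ≤ N := by
        have h1 := Polynomial.natDegree_divX_le (p := P)
        have h2 := Polynomial.natDegree_divX_le (p := Q)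
        rw [not_and_or] at hdeg
        rcases hdeg with h | h
        · have := Polynomial.natDegree_divX_eq_natDegree_tsub_one (p := P)
          omega
        · have := Polynomial.natDegree_divX_eq_natDegree_tsub_one (p := Q)
          omega
      have hdiv : divX P = divX Q := ih _ _ hlt hPd hQd hev'
      rw [← hdecP, ← hdecQ, hdiv, h0]

/-! ## `X = 3` over `𝕊[±1]` (balanced ternary) -/

/-- Existence of a balanced ternary digit polynomial for every integer. [folklore] -/
private theorem exists_poly_three (z : ℤ) :
    ∃ P : ℤ[X], (∀ j, P.coeff j = 0 ∨ P.coeff j = 1 ∨ P.coeff j = -1) ∧ P.eval 3 = z := by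
  -- strong induction on |z|
  suffices H : ∀ n : ℕ, ∀ z : ℤ, z.natAbs ≤ n →
      ∃ P : ℤ[X], (∀ j, P.coeff j = 0 ∨ P.coeff j = 1 ∨ P.coeff j = -1) ∧ P.eval 3 = z from
    H _ z le_rfl
  intro n
  induction n with
  | zero =>
    intro z hz
    have : z = 0 := by omega
    exact ⟨0, fun j => by simp, by simp [this]⟩
  | succ n ih =>
    intro z hz
    by_cases hz0 : z = 0
    · exact ⟨0, fun j => by simp, by simp [hz0]⟩
    -- z = 3 z' + d with d ∈ {-1, 0, 1}
    set d : ℤ := (z + 1) % 3 - 1 with hd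
    set z' : ℤ := (z + 1) / 3 with hz'
    have hzd : z = 3 * z' + d := by omega
    have hdig : d = 0 ∨ d = 1 ∨ d = -1 := by omega
    have hlt : z'.natAbs ≤ n := by omega
    obtain ⟨P', hP', hev'⟩ := ih z' hlt
    refine ⟨X * P' + C d, fun j => ?_, ?_⟩
    · rcases j with _ | j
      · simp [hdig]
      · simp only [coeff_add, coeff_X_mul, coeff_C_succ, add_zero]
        exact hP' j
    · simp [eval_add, eval_mul, hev', hzd]

/-- **Proposition 6.5 (first clause) / Intro footnote of *RR for the ring ℤ*: `X = 3` is an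
`𝕊[±1]`-generator of `ℤ`** — every integer is uniquely `P(3)` with `P` a polynomial with coefficients in
`{−1, 0, 1}` (balanced ternary). [cite: ConnesConsani2023MetaphysicsF1, Prop. 6.5 p. 25] -/
theorem isSMuGenerator_two_int_three : IsSMuGenerator 2 (3 : ℤ) := by
  intro z
  obtain ⟨P, hP, hev⟩ := exists_poly_three z
  refine ⟨P, ⟨fun j => (mem_digits_two_int _).mpr (hP j), hev⟩, ?_⟩
  rintro Q ⟨hQ, hevQ⟩
  refine (poly_unique (b := 3) (by norm_num) (D := insert 0 {x : ℤ | x ^ 2 = 1}) ?_ P Q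
    (fun j => (mem_digits_two_int _).mpr (hP j)) hQ (hev.trans hevQ.symm)).symm
  intro d hd d' hd' hdvd
  rw [mem_digits_two_int] at hd hd'
  rcases hd with rfl | rfl | rfl <;> rcases hd' with rfl | rfl | rfl <;> omega

/-! ## `X = −2` over `𝕊` (negabinary) -/

/-- Existence of a `{0,1}`-digit polynomial at `X = −2` for every integer. [folklore] -/
private theorem exists_poly_neg_two (z : ℤ) :
    ∃ P : ℤ[X], (∀ j, P.coeff j = 0 ∨ P.coeff j = 1) ∧ P.eval (-2) = z := by
  suffices H : ∀ n : ℕ, ∀ z : ℤ, z.natAbs ≤ n →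
      ∃ P : ℤ[X], (∀ j, P.coeff j = 0 ∨ P.coeff j = 1) ∧ P.eval (-2) = z from
    H _ z le_rfl
  intro n
  induction n with
  | zero =>
    intro z hz
    have : z = 0 := by omega
    exact ⟨0, fun j => by simp, by simp [this]⟩
  | succ n ih =>
    intro z hz
    by_cases hz0 : z = 0
    · exact ⟨0, fun j => by simp, by simp [hz0]⟩
    by_cases hz1 : z = -1
    · -- -1 = (-2) + 1
      refine ⟨X + C 1, fun j => ?_, by simp [hz1]⟩
      simp only [coeff_add, coeff_X, coeff_C]
      split_ifs <;> omega
    -- z = -2 z' + d, d = z mod 2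
    set d : ℤ := z % 2 with hd
    set z' : ℤ := (d - z) / 2 with hz'
    have hzd : z = -2 * z' + d := by omega
    have hdig : d = 0 ∨ d = 1 := by omega
    have hlt : z'.natAbs ≤ n := by omega
    obtain ⟨P', hP', hev'⟩ := ih z' hlt
    refine ⟨X * P' + C d, fun j => ?_, ?_⟩
    · rcases j with _ | j
      · simp [hdig]
      · simp only [coeff_add, coeff_X_mul, coeff_C_succ, add_zero]
        exact hP' j
    · simp [eval_add, eval_mul, hev', hzd]

/-- **§4 p. 14 / Intro footnote of *RR for the ring ℤ*: `X = −2` is an `𝕊`-generator of `ℤ`** — every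
integer is uniquely `P(−2)` with `P` a polynomial with coefficients in `{0, 1}` (negabinary).
[cite: ConnesConsani2023MetaphysicsF1, §4 p. 14] -/
theorem isSMuGenerator_one_int_neg_two : IsSMuGenerator 1 (-2 : ℤ) := by
  intro z
  obtain ⟨P, hP, hev⟩ := exists_poly_neg_two z
  refine ⟨P, ⟨fun j => (mem_digits_one_int _).mpr (hP j), hev⟩, ?_⟩
  rintro Q ⟨hQ, hevQ⟩
  refine (poly_unique (b := -2) (by norm_num) (D := insert 0 {x : ℤ | x ^ 1 = 1}) ?_ P Q
    (fun j => (mem_digits_one_int _).mpr (hP j)) hQ (hev.trans hevQ.symm)).symm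
  intro d hd d' hd' hdvd
  rw [mem_digits_one_int] at hd hd'
  rw [neg_dvd] at hdvd
  rcases hd with rfl | rfl <;> rcases hd' with rfl | rfl <;> omega

end Literature.NumberTheory.ConnesConsani2023

end
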